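import Summits.QuantumFields.YangMills.Theorems.LuscherReductionRunningReductionBOHandoverLabels
import HarnessLib

/-!
# Sub-window rung for «static-matching» (crux-ideate #1 on `LuscherReduction.DressedRitz`): `|λ_bare − λ| ≤ λ²` while `log L ≤ 1/(16 b₀ lam²)`

Elementary: on the part of the femto window with `log L ≤ 1/(16 b₀ lam²)` (and `lam ≤ 1/4`) the two-loop running label `λ(β,L)` and the bare
parameter `λ_bare = (2/β)^{1/3}` agree to `O(λ²)`.  This is the typed `SubWindowLabel` of `Sketch.lean` with `C = 1`, `lam0 = 1/4`.
-/

set_option autoImplicit false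

noncomputable section

open Real

namespace Summit.QuantumFields.YangMills.Cruxes.DressedRitz.StaticMatching

open Summit.QuantumFields.YangMills.Theorems.FemtoTransferGap
open Summit.QuantumFields.YangMills.Theorems.FemtoTransferGap.BOHandover

/-- `b₁/(2b₀²) = 51/121`. -/
theorem b1_div_two_b0_sq : b1 / (2 * b0 ^ 2) = 51 / 121 := by
  unfold b0 b1
  have hπ : (π : ℝ) ≠ 0 := Real.pi_ne_zero
  rw [div_eq_div_iff (by positivity) (by norm_num)]
  ring

/-- `2b₀ ≤ 11/108` (from `π > 3`). -/
theorem two_b0_le : 2 * b0 ≤ 11 / 108 := by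
  unfold b0
  have hπ : (3 : ℝ) < π := Real.pi_gt_three
  have hπ2 : (9 : ℝ) < π ^ 2 := by nlinarith
  rw [show (2 : ℝ) * (11 / (24 * π ^ 2)) = 11 / (12 * π ^ 2) by ring]
  rw [div_le_div_iff₀ (by positivity) (by norm_num)]
  nlinarith

/-- `b₁/b₀ ≤ 1/20`. -/
theorem b1_div_b0_le : b1 / b0 ≤ 1 / 20 := by
  have hb0 : 0 < b0 := by unfold b0; positivity
  have h : b1 / b0 = b1 / (2 * b0 ^ 2) * (2 * b0) := by field_simp
  rw [h, b1_div_two_b0_sq]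
  have := two_b0_le
  nlinarith

/-- `1/(2b₀) ≤ 18` (from `π ≤ 4`). -/
theorem inv_two_b0_le : 1 / (2 * b0) ≤ 18 := by
  unfold b0
  have hπ : π ≤ (4 : ℝ) := Real.pi_le_four
  have hπ0 : (0 : ℝ) < π := Real.pi_pos
  have hπ2 : π ^ 2 ≤ 16 := by nlinarith
  rw [show (1 : ℝ) / (2 * (11 / (24 * π ^ 2))) = 12 * π ^ 2 / 11 by field_simp; ring]
  rw [div_le_iff₀ (by norm_num)]
  nlinarith

/-- `λ_bare(β)³ = 2/β`. -/
theorem bareLambda_pow_three {β : ℝ} (hβ : 0 < β) : bareLambda β ^ 3 = 2 / β := by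
  unfold bareLambda
  rw [← Real.rpow_natCast, ← Real.rpow_mul (by positivity)]
  norm_num

theorem bareLambda_pos_of_pos {β : ℝ} (hβ : 0 < β) : 0 < bareLambda β := by
  unfold bareLambda
  exact Real.rpow_pos_of_pos (by positivity) _

/-! ### Pure real-inequality helpers (small contexts). -/

theorem aux_lam {lam l : ℝ} (hlam : 0 < lam) (hl : 0 < l) (hhi : l ≤ 2 * lam) :
    1 / (8 * lam ^ 2) ≤ 1 / (2 * l ^ 2) := by
  rw [div_le_div_iff₀ (by positivity) (by positivity)]
  nlinarith [mul_nonneg (sub_nonneg.2 hhi) (by positivity : (0 : ℝ) ≤ 2 * lam + l)]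

theorem aux_beta {β l I : ℝ} (hl : 0 < l) (hl1 : l ≤ 1 / 2) (hI3 : I = (l ^ 3)⁻¹)
    (h : (19 / 242) * β ≤ I + 1 / (2 * l ^ 2)) : β * l ^ 3 ≤ 20 := by
  have hl3 : 0 < l ^ 3 := pow_pos hl 3
  have h1 : (19 / 242) * β * l ^ 3 ≤ (I + 1 / (2 * l ^ 2)) * l ^ 3 := mul_le_mul_of_nonneg_right h hl3.le
  have e : (I + 1 / (2 * l ^ 2)) * l ^ 3 = 1 + l / 2 := by
    rw [hI3]; field_simp
  rw [e] at h1
  nlinarith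

theorem aux_lb_lower {β l lb : ℝ} (hl : 0 < l) (hβ0 : 0 < β) (hβl : β * l ^ 3 ≤ 20) (hlb3 : lb ^ 3 = 2 / β)
    (hlb : 0 < lb) : 9 / 20 * l ≤ lb := by
  have h1 : (9 / 20 * l) ^ 3 ≤ lb ^ 3 := by
    rw [hlb3, le_div_iff₀ hβ0]
    have hl3 : 0 < l ^ 3 := pow_pos hl 3
    nlinarith
  exact (pow_le_pow_iff_left₀ (by positivity) hlb.le three_ne_zero).1 h1

theorem aux_log_beta {β lb : ℝ} (hlb : 0 < lb) (hβ : β = 2 / lb ^ 3) : Real.log β ≤ 3 / lb := by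
  have e : Real.log β = Real.log 2 - 3 * Real.log lb := by
    rw [hβ, Real.log_div (by norm_num) (by positivity), Real.log_pow]; push_cast; ring
  have h2 : Real.log 2 ≤ 1 := by
    have := Real.log_le_sub_one_of_pos (show (0 : ℝ) < 2 by norm_num); linarith
  have h3 : Real.log lb⁻¹ ≤ lb⁻¹ - 1 := Real.log_le_sub_one_of_pos (inv_pos.mpr hlb)
  rw [Real.log_inv] at h3
  have h4 : lb⁻¹ = 1 / lb := inv_eq_one_div lb
  rw [h4] at h3
  have h5 : 3 / lb = 3 * (1 / lb) := by ring
  rw [e, h5]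
  linarith

theorem aux_log_two_b0 {β : ℝ} (hβ0 : 0 < β) : -Real.log β - 18 ≤ Real.log (2 * b0 / β) := by
  have hb0 : 0 < b0 := by unfold b0; positivity
  rw [Real.log_div (by positivity) hβ0.ne']
  have h1 : Real.log (2 * b0) = -Real.log (1 / (2 * b0)) := by
    rw [one_div, Real.log_inv, neg_neg]
  have h2 : Real.log (1 / (2 * b0)) ≤ 1 / (2 * b0) - 1 := Real.log_le_sub_one_of_pos (by positivity)
  have h3 := inv_two_b0_le
  rw [h1]
  linarith

theorem aux_three_div {l lb : ℝ} (hl : 0 < l) (hlbge : 9 / 20 * l ≤ lb) : 3 / lb ≤ 20 / (3 * l) := by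
  have h := div_le_div_of_nonneg_left (by norm_num : (0 : ℝ) ≤ 3) (by positivity : 0 < 9 / 20 * l) hlbge
  have e : (3 : ℝ) / (9 / 20 * l) = 20 / (3 * l) := by field_simp; ring
  rw [e] at h
  exact h

theorem aux_sum {l : ℝ} (hl : 0 < l) (hl1 : l ≤ 1 / 2) : 1 / (2 * l ^ 2) + 1 / (3 * l) + 9 / 10 ≤ 1 / l ^ 2 := by
  have hl0 : l ≠ 0 := hl.ne'
  rw [← sub_nonneg]
  have e : 1 / l ^ 2 - (1 / (2 * l ^ 2) + 1 / (3 * l) + 9 / 10) = (1 / 2 - l / 3 - 9 * l ^ 2 / 10) / l ^ 2 := by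
    field_simp; ring
  rw [e]
  apply div_nonneg _ (by positivity)
  nlinarith

theorem aux_cube {l : ℝ} (hl : 0 < l) (hl1 : l ≤ 1 / 2) : (l - l ^ 2) ^ 3 * (1 + l) ≤ l ^ 3 := by
  have h1 : 0 ≤ 1 - l := by linarith
  have h2 : (1 - l) ^ 2 ≤ 1 := by nlinarith
  have h3 : (1 - l) * (1 + l) ≤ 1 := by nlinarith
  have h4 : 0 ≤ (1 - l) * (1 + l) := by nlinarith
  have h5 : (1 - l) ^ 2 * ((1 - l) * (1 + l)) ≤ 1 := mul_le_one₀ h2 h4 h3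
  have e : (l - l ^ 2) ^ 3 * (1 + l) = l ^ 3 * ((1 - l) ^ 2 * ((1 - l) * (1 + l))) := by ring
  rw [e]
  have hl3 : 0 < l ^ 3 := pow_pos hl 3
  nlinarith

/-- **The rung.** `|λ_bare(β) − λ(β,L)| ≤ λ(β,L)²` on the sub-window `log L ≤ 1/(16 b₀ lam²)`, `lam ≤ 1/4`. -/
theorem subWindowLabel_explicit {lam : ℝ} (hlam : 0 < lam) (hlam0 : lam ≤ 1 / 4) (L : ℕ) [NeZero L] (β : ℝ)
    (hw : InFemtoWindow lam β L) (hlogL : Real.log L ≤ 1 / (16 * b0 * lam ^ 2)) :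
    |bareLambda β - luscherLambda β L| ≤ 1 * luscherLambda β L ^ 2 := by
  obtain ⟨hβ1, hlo, hhi⟩ := hw
  have hb0 : 0 < b0 := by unfold b0; positivity
  have hb1 : 0 < b1 := by unfold b1; positivity
  set l := luscherLambda β L with hl_def
  have hl : 0 < l := luscherLambda_pos_of_window hlam ⟨hβ1, hlo, hhi⟩
  have hl1 : l ≤ 1 / 2 := by linarith
  have hI : 0 < invRunningCoupling β L := invRunningCoupling_pos_of_luscherLambda_pos hl
  set I := invRunningCoupling β L with hI_def
  have hl3 : l ^ 3 = I⁻¹ := luscherLambda_pow_three hI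
  have hI3 : I = (l ^ 3)⁻¹ := by rw [hl3, inv_inv]
  have hβ0 : 0 < β := by linarith
  set lb := bareLambda β with hlb_def
  have hlb : 0 < lb := bareLambda_pos_of_pos hβ0
  have hlb3 : lb ^ 3 = 2 / β := bareLambda_pow_three hβ0
  have hβeq : β = 2 / lb ^ 3 := by rw [hlb3]; field_simp
  -- (A) lb ≤ l, from I ≤ β/2
  have hIle : I ≤ β / 2 := invRunningCoupling_le_half hβ1 L
  have hA3 : lb ^ 3 ≤ l ^ 3 := by
    rw [hlb3, hl3, show (2 : ℝ) / β = (β / 2)⁻¹ by rw [inv_div]]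
    exact inv_anti₀ hI hIle
  have hA : lb ≤ l := (pow_le_pow_iff_left₀ hlb.le hl.le three_ne_zero).1 hA3
  -- (B) the running defect β/2 − I ≤ 1/l²
  have hEq : I = β / 2 - 2 * b0 * Real.log (L : ℝ) + (b1 / b0) * Real.log (2 * b0 / β) := invRunningCoupling_eq β L
  have hB1 : 2 * b0 * Real.log (L : ℝ) ≤ 1 / (2 * l ^ 2) := by
    have h1 : 2 * b0 * Real.log (L : ℝ) ≤ 2 * b0 * (1 / (16 * b0 * lam ^ 2)) := mul_le_mul_of_nonneg_left hlogL (by positivity)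
    have h2 : 2 * b0 * (1 / (16 * b0 * lam ^ 2)) = 1 / (8 * lam ^ 2) := by field_simp; ring
    have h3 := aux_lam hlam hl hhi
    linarith
  have hlin : 1 - β / (2 * b0) ≤ Real.log (2 * b0 / β) := by
    have h := Real.one_sub_inv_le_log_of_pos (show 0 < 2 * b0 / β by positivity)
    rw [inv_div] at h
    exact h
  have hK : 0 ≤ b1 / b0 := (div_pos hb1 hb0).le
  have hβup : (19 / 242) * β ≤ I + 1 / (2 * l ^ 2) := by
    have h1 : (b1 / b0) * (1 - β / (2 * b0)) ≤ (b1 / b0) * Real.log (2 * b0 / β) := mul_le_mul_of_nonneg_left hlin hK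
    have h2 : (b1 / b0) * (1 - β / (2 * b0)) = b1 / b0 - (b1 / (2 * b0 ^ 2)) * β := by field_simp
    rw [h2, b1_div_two_b0_sq] at h1
    linarith
  have hβl : β * l ^ 3 ≤ 20 := aux_beta hl hl1 hI3 hβup
  have hlbge : 9 / 20 * l ≤ lb := aux_lb_lower hl hβ0 hβl hlb3 hlb
  have hlogβ : Real.log β ≤ 3 / lb := aux_log_beta hlb hβeq
  have hlog2 : -Real.log β - 18 ≤ Real.log (2 * b0 / β) := aux_log_two_b0 hβ0
  have h3lb : 3 / lb ≤ 20 / (3 * l) := aux_three_div hl hlbge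
  have hsum := aux_sum hl hl1
  have hB : β / 2 - I ≤ 1 / l ^ 2 := by
    have hT : -(3 / lb) - 18 ≤ Real.log (2 * b0 / β) := by linarith
    have h1 : (b1 / b0) * (-(3 / lb) - 18) ≤ (b1 / b0) * Real.log (2 * b0 / β) := mul_le_mul_of_nonneg_left hT hK
    have hpos : 0 ≤ 3 / lb + 18 := by positivity
    have h2 : (b1 / b0) * (3 / lb + 18) ≤ (1 / 20) * (3 / lb + 18) := mul_le_mul_of_nonneg_right b1_div_b0_le hpos
    have h4 : (1 : ℝ) / 20 * (20 / (3 * l)) = 1 / (3 * l) := by field_simp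
    linarith
  -- (C) conclude: lb³(1+l) ≥ l³ ≥ (l − l²)³(1+l), so lb ≥ l − l²
  have hC1 : l ^ 3 ≤ lb ^ 3 * (1 + l) := by
    -- β ≤ 2I + 2/l² = (2 + 2l)/l³, i.e. β l³ ≤ 2(1+l); and lb³ β = 2
    have h1 : β ≤ 2 * I + 2 * (1 / l ^ 2) := by linarith
    have hl3pos : 0 < l ^ 3 := pow_pos hl 3
    have h2 : β * l ^ 3 ≤ 2 * (1 + l) := by
      have := mul_le_mul_of_nonneg_right h1 hl3pos.le
      have e : (2 * I + 2 * (1 / l ^ 2)) * l ^ 3 = 2 * (1 + l) := by rw [hI3]; field_simp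
      linarith
    have h3 : lb ^ 3 * β = 2 := by rw [hlb3]; field_simp
    nlinarith [pow_pos hlb 3]
  have hC2 : (l - l ^ 2) ^ 3 ≤ lb ^ 3 := by
    have h := aux_cube hl hl1
    have h1l : 0 < 1 + l := by linarith
    exact le_of_mul_le_mul_right (h.trans hC1) h1l
  have hll : 0 ≤ l - l ^ 2 := by nlinarith
  have hC3 : l - l ^ 2 ≤ lb := (pow_le_pow_iff_left₀ hll hlb.le three_ne_zero).1 hC2
  rw [abs_of_nonpos (by linarith), one_mul]
  linarith

/-- Packaged as the `∃ C lam0` form (`C = 1`, `lam0 = 1/4`); identical to `StaticMatching.SubWindowLabel` of the Sketch. -/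
theorem subWindowLabel :
    ∃ C lam0 : ℝ, 0 < lam0 ∧ ∀ lam : ℝ, 0 < lam → lam ≤ lam0 → ∀ (L : ℕ) [NeZero L] (β : ℝ),
      InFemtoWindow lam β L → Real.log L ≤ 1 / (16 * b0 * lam ^ 2) →
        |bareLambda β - luscherLambda β L| ≤ C * luscherLambda β L ^ 2 :=
  ⟨1, 1 / 4, by norm_num, fun _lam hlam hlam0 L _ β hw hlog => subWindowLabel_explicit hlam hlam0 L β hw hlog⟩

end Summit.QuantumFields.YangMills.Cruxes.DressedRitz.StaticMatching

end
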